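import Mathlib
import Summits.PneNP.PneNP.Theorems.PstarGapLemma

/-!
# Linearisation is linearly bounded: sparse vectors of a subspace touch few coordinates (ROUND-24 item T24.8b)

FRONTIER range-avoidance ladder (cell `pnp-ideate`, ROUND-24 gap-lemma programme; restricted-model combinatorics — nothing here bears
on `P` versus `NP`).

An ingredient of the planned proof of `PstarGapLemma.PstarGapLemmaSO` (memo §13): the outputs whose AND monomial a parity system `W`
can LINEARISE — those `j` for which the span `U` of the board contains a nonzero vector supported inside the AND pair of `j` — are at
most `2Δ · dim U` in number under `MaxDegree Δ` (`card_linearised_le`).  The linear algebra behind it (`card_touched_le`): a finite set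
`E` of nonzero vectors of weight `≤ 2` touches at most `2 · finrank (span E)` coordinates.  Proof by induction on `#E`: a coordinate
touched by exactly one vector `w` is lost together with `w`, and the span drops strictly (every other vector vanishes there); if no such
LEAF coordinate exists, a dependent vector can be removed without losing coordinates, and an independent leafless `E` has
`2·#touched ≤ Σ weights ≤ 2·#E = 2·finrank`.  Then each touched coordinate lies in the AND pair of at most `Δ` outputs.
-/

set_option linter.dupNamespace false -- `Summit.PneNP.PneNP.…`: summit = sub-problem name (D-0017 single-conjunct layout)

open Finset Module Literature.Computability.Complexity
open Summit.PneNP.PneNP.Theorems.PstarSALevel (varSet)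
open Summit.PneNP.PneNP.Theorems.PstarGapLemma (MaxDegree)

namespace Summit.PneNP.PneNP.Theorems.PstarGapLinearised

section LinearAlgebra

variable {K : Type*} [Field K] [DecidableEq K] {ι : Type*} [Fintype ι] [DecidableEq ι]

/-- The support of a vector as a finset of coordinates. -/
def supp (u : ι → K) : Finset ι := univ.filter fun v => u v ≠ 0

/-- The coordinates touched by a set of vectors. -/
def touched (E : Finset (ι → K)) : Finset ι := E.biUnion supp

omit [DecidableEq ι] in
/-- A vector with empty support is zero. -/
theorem eq_zero_of_supp_eq_empty {u : ι → K} (h : supp u = ∅) : u = 0 := by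
  funext v
  by_contra hv
  have : v ∈ supp u := mem_filter.2 ⟨mem_univ _, hv⟩
  rw [h] at this
  exact notMem_empty _ this

omit [DecidableEq K] [Fintype ι] [DecidableEq ι] in
/-- Vectors vanishing at `v` span a subspace vanishing at `v`. -/
theorem apply_eq_zero_of_mem_span {E : Finset (ι → K)} {v : ι} (hE : ∀ u ∈ E, u v = 0) {x : ι → K}
    (hx : x ∈ Submodule.span K (E : Set (ι → K))) : x v = 0 := by
  have hle : Submodule.span K (E : Set (ι → K)) ≤ LinearMap.ker (LinearMap.proj v : (ι → K) →ₗ[K] K) := by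
    rw [Submodule.span_le]
    intro u hu
    rw [SetLike.mem_coe, LinearMap.mem_ker]
    exact hE u hu
  have := hle hx
  rw [LinearMap.mem_ker] at this
  exact this

/-- **Sparse vectors touch few coordinates**: nonzero vectors of weight `≤ 2` touch at most `2 · finrank (span)` coordinates. -/
theorem card_touched_le (E : Finset (ι → K)) (hE : ∀ u ∈ E, u ≠ 0 ∧ (supp u).card ≤ 2) :
    (touched E).card ≤ 2 * finrank K (Submodule.span K (E : Set (ι → K))) := by
  induction E using Finset.strongInduction with
  | H E ih =>
    by_cases hleaf : ∃ v ∈ touched E, (E.filter fun u => u v ≠ 0).card = 1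
    · -- Case A: a leaf coordinate `v`, touched by exactly one vector `w`
      obtain ⟨v, hv, h1⟩ := hleaf
      obtain ⟨w, hw⟩ := card_eq_one.1 h1
      have hwm : w ∈ E.filter (fun u => u v ≠ 0) := by rw [hw]; exact mem_singleton_self _
      rw [mem_filter] at hwm
      have hothers : ∀ u ∈ E.erase w, u v = 0 := by
        intro u hu
        by_contra hne
        have : u ∈ E.filter (fun u => u v ≠ 0) := mem_filter.2 ⟨mem_of_mem_erase hu, hne⟩
        rw [hw, mem_singleton] at this
        exact ne_of_mem_erase hu this
      have ih' := ih (E.erase w) (erase_ssubset hwm.1) (fun u hu => hE u (mem_of_mem_erase hu))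
      have hC : (touched E).card ≤ (touched (E.erase w)).card + 2 := by
        have hsub : touched E ⊆ touched (E.erase w) ∪ supp w := by
          intro x hx
          obtain ⟨u, hu, hxu⟩ := mem_biUnion.1 hx
          by_cases huw : u = w
          · exact mem_union_right _ (huw ▸ hxu)
          · exact mem_union_left _ (mem_biUnion.2 ⟨u, mem_erase.2 ⟨huw, hu⟩, hxu⟩)
        exact (card_le_card hsub).trans ((card_union_le _ _).trans (Nat.add_le_add_left (hE w hwm.1).2 _))
      have hlt : Submodule.span K ((E.erase w : Finset (ι → K)) : Set (ι → K)) < Submodule.span K (E : Set (ι → K)) := by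
        refine lt_of_le_of_ne (Submodule.span_mono (fun x hx => by rw [coe_erase] at hx; exact hx.1)) ?_
        intro heq
        have hwin : w ∈ Submodule.span K ((E.erase w : Finset (ι → K)) : Set (ι → K)) := by
          rw [heq]; exact Submodule.subset_span hwm.1
        exact hwm.2 (apply_eq_zero_of_mem_span hothers hwin)
      have hdim := Submodule.finrank_lt_finrank_of_lt hlt
      omega
    · push Not at hleaf
      have htwo : ∀ v ∈ touched E, 2 ≤ (E.filter fun u => u v ≠ 0).card := by
        intro v hv
        have h1 : 1 ≤ (E.filter fun u => u v ≠ 0).card := by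
          obtain ⟨u, hu, hvu⟩ := mem_biUnion.1 hv
          exact card_pos.2 ⟨u, mem_filter.2 ⟨hu, (mem_filter.1 hvu).2⟩⟩
        have := hleaf v hv
        omega
      by_cases hind : LinearIndepOn K id (E : Set (ι → K))
      · -- Case C: independent and leafless — double counting
        rw [finrank_span_finset_eq_card hind]
        have h1 : 2 * (touched E).card ≤ ∑ u ∈ E, (supp u).card := by
          have hsuppT : ∀ u ∈ E, supp u = (touched E).filter fun v => u v ≠ 0 := by
            intro u hu
            ext v
            rw [mem_filter]
            constructor
            · intro h
              exact ⟨mem_biUnion.2 ⟨u, hu, h⟩, (mem_filter.1 h).2⟩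
            · rintro ⟨-, h⟩
              exact mem_filter.2 ⟨mem_univ _, h⟩
          have hinc : ∑ u ∈ E, (supp u).card = ∑ v ∈ touched E, (E.filter fun u => u v ≠ 0).card := by
            rw [sum_congr rfl fun u hu => by rw [hsuppT u hu, card_filter], sum_comm]
            refine sum_congr rfl fun v _ => ?_
            rw [card_filter]
          rw [hinc]
          have := sum_le_sum fun v hv => htwo v hv
          rw [sum_const, smul_eq_mul] at this
          linarith
        have h2 : ∑ u ∈ E, (supp u).card ≤ 2 * E.card := by
          have := sum_le_sum fun u hu => (hE u hu).2
          rw [sum_const, smul_eq_mul] at this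
          linarith
        omega
      · -- Case B: leafless and dependent — drop a dependent vector, nothing is lost
        rw [linearIndepOn_iff_notMem_span] at hind
        push Not at hind
        obtain ⟨w, hwE, hwspan⟩ := hind
        rw [Set.image_id] at hwspan
        have hwspan' : w ∈ Submodule.span K ((E.erase w : Finset (ι → K)) : Set (ι → K)) := by
          rw [coe_erase]; exact hwspan
        have hspan : Submodule.span K ((E.erase w : Finset (ι → K)) : Set (ι → K)) = Submodule.span K (E : Set (ι → K)) := by
          conv_rhs => rw [← insert_erase hwE, coe_insert]
          rw [Submodule.span_insert_eq_span hwspan']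
        have hC : touched E = touched (E.erase w) := by
          apply Subset.antisymm
          · intro v hv
            obtain ⟨u, hu, hvu⟩ := mem_biUnion.1 hv
            by_cases huw : u = w
            · obtain ⟨u', hu', hne⟩ := exists_mem_ne (htwo v hv) u
              rw [mem_filter] at hu'
              exact mem_biUnion.2 ⟨u', mem_erase.2 ⟨huw ▸ hne, hu'.1⟩, mem_filter.2 ⟨mem_univ _, hu'.2⟩⟩
            · exact mem_biUnion.2 ⟨u, mem_erase.2 ⟨huw, hu⟩, hvu⟩
          · exact biUnion_subset_biUnion_of_subset_left _ (erase_subset _ _)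
        rw [hC, ← hspan]
        exact ih (E.erase w) (erase_ssubset hwE) (fun u hu => hE u (mem_of_mem_erase hu))

end LinearAlgebra

/-! ## The count of linearisable outputs -/

variable {n m : ℕ}

/-- The AND pair of output `j`. -/
def andPair (I : LocalMap 4 n m) (j : Fin m) : Finset (Fin n) := {I.vars j 2, I.vars j 3}

/-- The AND pair lies in the variable set. -/
theorem andPair_subset_varSet (I : LocalMap 4 n m) (j : Fin m) : andPair I j ⊆ varSet I j := by
  intro v hv
  unfold andPair at hv
  unfold PstarSALevel.varSet
  rw [mem_insert, mem_singleton] at hv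
  rcases hv with rfl | rfl <;> exact mem_image.2 ⟨_, mem_univ _, rfl⟩

open Classical in
/-- **T24.8b — linearisation is linearly bounded.**  Under `MaxDegree Δ`, the outputs whose AND pair supports a nonzero vector of
the subspace `U ≤ 𝔽₂ⁿ` are at most `2Δ · finrank U`. -/
theorem card_linearised_le {Δ : ℕ} (I : LocalMap 4 n m) (hD : MaxDegree Δ I) (U : Submodule (ZMod 2) (Fin n → ZMod 2)) :
    (univ.filter fun j : Fin m => ∃ u ∈ U, u ≠ 0 ∧ supp u ⊆ andPair I j).card ≤ 2 * Δ * finrank (ZMod 2) U := by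
  classical
  set E : Finset (Fin n → ZMod 2) := univ.filter fun u => u ∈ U ∧ u ≠ 0 ∧ ∃ j : Fin m, supp u ⊆ andPair I j with hEdef
  have hE : ∀ u ∈ E, u ≠ 0 ∧ (supp u).card ≤ 2 := by
    intro u hu
    rw [hEdef, mem_filter] at hu
    obtain ⟨-, -, hu0, j, hj⟩ := hu
    exact ⟨hu0, (card_le_card hj).trans (card_insert_le _ _)⟩
  have hspan : finrank (ZMod 2) (Submodule.span (ZMod 2) (E : Set (Fin n → ZMod 2))) ≤ finrank (ZMod 2) U := by
    apply Submodule.finrank_mono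
    rw [Submodule.span_le]
    intro u hu
    rw [mem_coe, hEdef, mem_filter] at hu
    exact hu.2.1
  have hC := card_touched_le E hE
  have hsub : (univ.filter fun j : Fin m => ∃ u ∈ U, u ≠ 0 ∧ supp u ⊆ andPair I j) ⊆
      (touched E).biUnion fun v => univ.filter fun j : Fin m => v ∈ varSet I j := by
    intro j hj
    rw [mem_filter] at hj
    obtain ⟨-, u, huU, hu0, hsup⟩ := hj
    have huE : u ∈ E := by rw [hEdef, mem_filter]; exact ⟨mem_univ _, huU, hu0, j, hsup⟩
    have hne : (supp u).Nonempty := by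
      rw [nonempty_iff_ne_empty]
      exact fun h => hu0 (eq_zero_of_supp_eq_empty h)
    obtain ⟨v, hv⟩ := hne
    exact mem_biUnion.2 ⟨v, mem_biUnion.2 ⟨u, huE, hv⟩, mem_filter.2 ⟨mem_univ _, andPair_subset_varSet I j (hsup hv)⟩⟩
  calc (univ.filter fun j : Fin m => ∃ u ∈ U, u ≠ 0 ∧ supp u ⊆ andPair I j).card
      ≤ ((touched E).biUnion fun v => univ.filter fun j : Fin m => v ∈ varSet I j).card := card_le_card hsub
    _ ≤ ∑ v ∈ touched E, (univ.filter fun j : Fin m => v ∈ varSet I j).card := card_biUnion_le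
    _ ≤ ∑ _v ∈ touched E, Δ := sum_le_sum fun v _ => hD v
    _ = (touched E).card * Δ := by rw [sum_const, smul_eq_mul]
    _ ≤ 2 * finrank (ZMod 2) (Submodule.span (ZMod 2) (E : Set (Fin n → ZMod 2))) * Δ := Nat.mul_le_mul_right _ hC
    _ ≤ 2 * Δ * finrank (ZMod 2) U := by nlinarith
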